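import Summits.QuantumFields.YangMills.Theorems.BalabanUVNodesN20TwoRunKeyedGoodClassMass

/-!
# BalabanUVNodes ∕ N20 (NE7b) — THE GOOD FIBRE AND THE GOOD-CLASS MASS OF RUN B, FLOW-FREE: for EVERY run B (NO coupling hypothesis `RAgree`) the flow-free truncation
# `truncShift` has fibre `{liftShift u}` over every admissible index `u` of run B's own history read one level up with `u.Ω_1 = T_η`, the flow-free lift is a BIJECTION from
# that history's level-`j` small-field class onto run B's level-`(j+1)` class, and run B's good-class keyed mass at the persistence class is the flow-free lifted-term mass

Cell `pub-ymgap` (HUMAN RULING D-0062 Track A; work-bound push D-0149, director-ym №197), width seat `pub-ymgap-dag-n20-w2` (gen 0) on node N20 = NE7b; fourth module of plan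
g77 `W-SEAT-START-LIST.md` §2 n20 ITEM 2's theme — the FLOW-FREE twin of module 2 §3 (`…N20TwoRunKeyedGoodFibre`, p586099) and module 3 §1∕§3 (`…N20TwoRunKeyedGoodClassMass`):
those are stated under node U5d's DISPLAYED coupling hypothesis `RAgree` (equality of the (2.5) cube factors of the two runs' histories on the window — a FLOW statement that fails on
the jump window of `RkOfRecord`, dag-n20-d `Node00/TwoRunSiteTransport`); dag-n20-d's `Node00/TwoRunSiteKey` ∕ `TwoRunSiteLift` typed the flow-free objects (`truncShift`,
`liftShift`, `rAgree_shift` = `rfl`) precisely so that run B's keyed classes need NO flow hypothesis.  This module says the good-fibre ∕ good-class structure needs none either.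
Filed `--kind proof --supports stmt-QuantumFields-20544 --as helper` (K3⁷ `SpineGivenEndpointR13SepCoPH`); COUNT-NEUTRAL.  [III] = [Balaban1988Convergent], [LF-I] =
[Balaban1989LargeFieldI].  (α) READING as in module 1 (`Bad K t := badKeysSigma F (T K) jcut`, dag-n20-d).

CONTENT (theorems only; `gB` = ONE run-B history, `u` ranges over `Seq (DOfRecord F ν M (fun j ↦ gB (j+1)) K) k` = the admissible indices of run B's history READ ONE LEVEL UP):
* §1 `liftShift_Λ_one` · ★ `truncShift_eq_iff_eq_liftShift_of_Ω_one` (`truncShift s' = u ↔ s' = liftShift u` when `u.Ω_1 = T_η`, `k ≥ 1`) · ★ `filter_truncShift_eq_singleton_liftShift`;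
* §2 `truncShift_Λ_eq_univ_iff` · `liftShift_Λ_succ_eq_univ_iff` · `eq_liftShift_truncShift_of_Λ_succ_eq_univ` · ★ `filter_Λ_succ_eq_univ_eq_image_liftShift` (`{s' : Λ'_{j+1} = T_η} =
  liftShift '' {u : Λ_j = T_η}`, `1 ≤ j ≤ k`) · `liftShift_injective` · ★ `sum_filter_Λ_succ_eq_univ_eq_sum_liftShift`;
* §3 ★★ `sum_sdiff_badKeysSigma_fiberB_eq_sum_liftShift` (policy `1 ≤ jcut K ≤ K₀+K`, class set `T ⊇` run B's keys, ANY weight: `Σ_{x ∈ T ∖ badKeysSigma} B x = Σ_{u : u.Λ (jcut K) = T_η}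
  w (liftShift u)`).  Under `RAgree` the shifted history's classes ARE run A's (`Node00.dOfRecord_shift_eq_of_rAgree`) and module 3's `…_eq_sum_liftSeq` is the same sum; OFF `RAgree`
  this is the honest statement: run B's good class is indexed by its OWN coarse history's good class, whether or not that coincides with run A's index type.
Cited BY NAME, not re-typed: modules 1–3, dag-n20-d `Node00/TwoRunSite{Transport,Key,Lift,Persistence}` (`truncShift_Ω∕_Λ`, `liftShift`, `liftShift_Ω_one∕_Λ_succ`,
`truncShift_liftShift`, `blockUpSet_eq_univ_iff`), `B14Eq218Concrete.Chain21.Λ_subset_Ω_of_le`.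

HONEST FRAMING.  Finite bookkeeping + torus geometry (Mathlib + tree shapes BY NAME); NO weight is bounded, NO estimate proved.  dag-n20-w3's LOCATED-1 (INBOX 2026-08-27) stands
(the persistence class at the (2.18) index is «created», its good class asymptotically weightless at an identity∕junk pin).  Nothing of Bałaban's is asserted; NE7 ∕ NE7b ∕ NE7c NOT
PRINTED for `d = 4`, NOT proved; (α)-instance 0∕1; N19 ∕ N20 ∕ N21 ∕ N27 NOT discharged; K3⁷ NOT closed; counts unmoved (typed 28∕28 · discharged 5∕27); no count claim.  One finite
`𝕋⁴_{L^K}` programme at fixed `ε = L^{−K}` along two consecutive cutoffs, Bałaban AS PRINTED; the YM mass gap (Clay) is NOT proved by any of this — R4 closes the conditional finite-𝕋⁴ rung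
`BalabanLadder.UV` only; NOT ℝ⁴, NOT OS.  No `def`, no `instance`, no `notation`, no `sorry`.  Sources (bookkeeping): [III] (2.1) p.254, (2.5) p.255, (2.18) p.257; [LF-I] (0.2)–(0.4) p.176;
[King1986] (3.10) p.656.
-/

noncomputable section

open scoped BigOperators

namespace Summit.QuantumFields.YangMills.BalabanUVNodes.N20TwoRunKeyedGoodFibreFlowFree

open Literature.MathematicalPhysics.QuantumFieldTheory.Balaban1983to89 Literature.MathematicalPhysics.QuantumFieldTheory.Balaban1983to89.Node00
open T4Continuum B14.Eq213MaximalDomains B15Eq112TorusCover B14DomainGeom B14.Eq218Concrete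
open Summit.QuantumFields.YangMills.BalabanUVNodes.N20TwoRunKeyedPersistentWeight
  (blockDownSet_seq_Λ_succ_eq_univ_iff blockDownSet_eq_univ_iff_of_mem_dOfRecord_succ sigma_twoRunKeyB_mem_badKeysSigma_iff)
open Summit.QuantumFields.YangMills.BalabanUVNodes.N20TwoRunKeyedGoodFibre (eq_of_truncShift_eq_of_levelOne_eq seq_Λ_one_eq_univ_of_Ω_two)
open Summit.QuantumFields.YangMills.BalabanUVNodes.N20TwoRunKeyedGoodClassMass (sum_sdiff_fiberB_eq_sum_filter)

variable (F : T4Family) (ν : Stage7Numerics) {M : ℕ} (hM : 0 < M) (gB : ℕ → ℝ) {K k : ℕ}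

/-! ## §1  Flow-free (NO `RAgree`): the `truncShift`-fibre over a shifted-history index with `Ω_1 = T_η` is `{liftShift u}` -/

/-- Level `1` of the flow-free lift: `Λ'_1 = T_η` (companion of `Node00.liftShift_Ω_one`). [cite: Balaban1988Convergent, (2.18) p.257 (bookkeeping)] -/
theorem liftShift_Λ_one (u : Seq (DOfRecord F ν M (fun j => gB (j + 1)) K) k) : (liftShift F ν hM gB u).Λ 1 = Set.univ := by
  unfold liftShift
  rw [Seq.ofChain_Λ _ le_rfl (by omega), liftFun_one]

/-- **★ FLOW-FREE SINGLETON**: for EVERY run B (no coupling hypothesis), the flow-free truncation `truncShift` («drop level 1, block down by `L`») has fibre `{liftShift u}`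
over every admissible index `u` of run B's own history read one level up with `u.Ω_1 = T_η` (`k ≥ 1`): a partner `s'` has `blockDownSet Ω'_2 = T_η`, so `Ω'_2 = T_η` (module 1
§1), so `Λ'_1 = Ω'_1 = T_η` by (2.1), and `truncShift` is injective above level 1 (module 2 §1). [cite: Balaban1988Convergent, (2.1) p.254, (2.18) p.257 (bookkeeping)] -/
theorem truncShift_eq_iff_eq_liftShift_of_Ω_one (hk : 1 ≤ k) (u : Seq (DOfRecord F ν M (fun j => gB (j + 1)) K) k) (hΩ : u.Ω 1 = Set.univ)
    (s' : SeqOfRecord F ν M gB (K + 1) (k + 1)) : truncShift F ν hM gB s' = u ↔ s' = liftShift F ν hM gB u := by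
  refine ⟨fun h => ?_, fun h => h ▸ truncShift_liftShift F ν hM gB u⟩
  have hΩ2 : s'.Ω 2 = Set.univ := by
    have h1 : blockDownSet F K (s'.Ω (1 + 1)) = Set.univ := by rw [← truncShift_Ω F ν hM gB s' le_rfl hk, h, hΩ]
    exact (blockDownSet_eq_univ_iff_of_mem_dOfRecord_succ F ν M gB K 1 (s'.chain.memΩ (1 + 1) (by omega) (by omega))).1 h1
  obtain ⟨hΛ1, hΩ1⟩ := seq_Λ_one_eq_univ_of_Ω_two s' (by omega) hΩ2
  refine eq_of_truncShift_eq_of_levelOne_eq F ν hM gB (h.trans (truncShift_liftShift F ν hM gB u).symm) ?_ ?_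
  · rw [hΩ1, liftShift_Ω_one]
  · rw [hΛ1, liftShift_Λ_one]

open Classical in
/-- **★ AS A FINSET**: `{s' : truncShift s' = u} = {liftShift u}` for `u.Ω_1 = T_η`, `k ≥ 1` — every run B. [cite: Balaban1988Convergent, (2.18) p.257 (bookkeeping)] -/
theorem filter_truncShift_eq_singleton_liftShift (hk : 1 ≤ k) (u : Seq (DOfRecord F ν M (fun j => gB (j + 1)) K) k) (hΩ : u.Ω 1 = Set.univ) :
    Finset.univ.filter (fun s' : SeqOfRecord F ν M gB (K + 1) (k + 1) => truncShift F ν hM gB s' = u) = {liftShift F ν hM gB u} := by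
  ext s'
  simp only [Finset.mem_filter, Finset.mem_univ, true_and, Finset.mem_singleton]
  exact truncShift_eq_iff_eq_liftShift_of_Ω_one F ν hM gB hk u hΩ s'

/-! ## §2  Flow-free: the lift is a bijection from the shifted history's level-`j` small-field class onto run B's level-`(j+1)` small-field class -/

/-- `(truncShift s').Λ_j = T_η ↔ s'.Λ_{j+1} = T_η` on the window (module 1 §1's exactness). [cite: Balaban1988Convergent, (2.1) p.254, (2.18) p.257 (bookkeeping)] -/
theorem truncShift_Λ_eq_univ_iff (s' : SeqOfRecord F ν M gB (K + 1) (k + 1)) {j : ℕ} (h1 : 1 ≤ j) (hj : j ≤ k) :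
    (truncShift F ν hM gB s').Λ j = Set.univ ↔ s'.Λ (j + 1) = Set.univ := by
  rw [truncShift_Λ F ν hM gB s' h1 hj]
  exact blockDownSet_seq_Λ_succ_eq_univ_iff F ν M gB s' hj

/-- `(liftShift u).Λ_{j+1} = T_η ↔ u.Λ_j = T_η` on the window (`Node00.blockUpSet_eq_univ_iff`). [cite: Balaban1988Convergent, (2.18) p.257 (bookkeeping)] -/
theorem liftShift_Λ_succ_eq_univ_iff (u : Seq (DOfRecord F ν M (fun j => gB (j + 1)) K) k) {j : ℕ} (h1 : 1 ≤ j) (hj : j ≤ k) :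
    (liftShift F ν hM gB u).Λ (j + 1) = Set.univ ↔ u.Λ j = Set.univ := by
  rw [liftShift_Λ_succ F ν hM gB u h1 hj, blockUpSet_eq_univ_iff]

/-- **A RUN-B INDEX WITH NO LARGE FIELD AT SOME LEVEL `j + 1 ≥ 2` IS THE FLOW-FREE LIFT OF ITS FLOW-FREE TRUNCATION** (`1 ≤ j ≤ k`; every run B).
[cite: Balaban1988Convergent, (2.1) p.254, (2.18) p.257 (bookkeeping)] -/
theorem eq_liftShift_truncShift_of_Λ_succ_eq_univ (s' : SeqOfRecord F ν M gB (K + 1) (k + 1)) {j : ℕ} (h1 : 1 ≤ j) (hj : j ≤ k)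
    (h : s'.Λ (j + 1) = Set.univ) : s' = liftShift F ν hM gB (truncShift F ν hM gB s') := by
  have hΩ2 : s'.Ω 2 = Set.univ :=
    Set.eq_univ_of_univ_subset (h ▸ s'.chain.Λ_subset_Ω_of_le (j := 2) (j' := j + 1) (by omega) (by omega) (by omega))
  refine (truncShift_eq_iff_eq_liftShift_of_Ω_one F ν hM gB (h1.trans hj) (truncShift F ν hM gB s') ?_ s').1 rfl
  rw [truncShift_Ω F ν hM gB s' le_rfl (h1.trans hj), hΩ2, blockDownSet_univ]

open Classical in
/-- **★ FLOW-FREE BIJECTION OF SMALL-FIELD CLASSES**: run B's admissible indices with `Λ'_{j+1} = T_η` are EXACTLY the flow-free lifts of the admissible indices of run B's own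
history read one level up with `Λ_j = T_η` (`1 ≤ j ≤ k`; every run B, no coupling hypothesis). [cite: Balaban1988Convergent, (2.1) p.254, (2.18) p.257 (bookkeeping)] -/
theorem filter_Λ_succ_eq_univ_eq_image_liftShift {j : ℕ} (h1 : 1 ≤ j) (hj : j ≤ k) :
    Finset.univ.filter (fun s' : SeqOfRecord F ν M gB (K + 1) (k + 1) => s'.Λ (j + 1) = Set.univ)
      = (Finset.univ.filter (fun u : Seq (DOfRecord F ν M (fun j => gB (j + 1)) K) k => u.Λ j = Set.univ)).image (liftShift F ν hM gB) := by
  ext s'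
  simp only [Finset.mem_filter, Finset.mem_univ, true_and, Finset.mem_image]
  constructor
  · intro h
    exact ⟨truncShift F ν hM gB s', (truncShift_Λ_eq_univ_iff F ν hM gB s' h1 hj).2 h, (eq_liftShift_truncShift_of_Λ_succ_eq_univ F ν hM gB s' h1 hj h).symm⟩
  · rintro ⟨u, hu, rfl⟩
    exact (liftShift_Λ_succ_eq_univ_iff F ν hM gB u h1 hj).2 hu

/-- The flow-free lift is injective (a section of `truncShift`: `Node00.truncShift_liftShift`). [cite: Balaban1988Convergent, (2.18) p.257 (bookkeeping)] -/
theorem liftShift_injective : Function.Injective (liftShift F ν hM gB (K := K) (k := k)) :=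
  Function.LeftInverse.injective (truncShift_liftShift F ν hM gB)

open Classical in
/-- **★ FLOW-FREE RE-INDEXING**: `Σ_{s' : Λ'_{j+1} = T_η} w s' = Σ_{u : Λ_j = T_η} w (liftShift u)` for ANY weight `w` on run B's indices (`1 ≤ j ≤ k`; every run B).
[cite: Balaban1988Convergent, (2.18) p.257; King1986, (3.10) p.656 (bookkeeping)] -/
theorem sum_filter_Λ_succ_eq_univ_eq_sum_liftShift {j : ℕ} (h1 : 1 ≤ j) (hj : j ≤ k) {β : Type*} [AddCommMonoid β]
    (w : SeqOfRecord F ν M gB (K + 1) (k + 1) → β) :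
    ∑ s' ∈ Finset.univ.filter (fun s' : SeqOfRecord F ν M gB (K + 1) (k + 1) => s'.Λ (j + 1) = Set.univ), w s'
      = ∑ u ∈ Finset.univ.filter (fun u : Seq (DOfRecord F ν M (fun j => gB (j + 1)) K) k => u.Λ j = Set.univ), w (liftShift F ν hM gB u) := by
  rw [filter_Λ_succ_eq_univ_eq_image_liftShift F ν hM gB h1 hj, Finset.sum_image fun _ _ _ _ h => liftShift_injective F ν hM gB h]

/-! ## §3  At the σ-packed two-run keys, flow-free: run B's GOOD-class keyed mass at the persistence class is the flow-free lifted-term mass -/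

section Keys

variable (K₀ : ℕ) [∀ Kc, DecidableEq (SiteSeqKey F Kc)]

open Classical in
/-- **★★ FLOW-FREE: RUN B's GOOD-CLASS KEYED MASS AT `badKeysSigma` IS A SUM OVER THE SHIFTED HISTORY's SINGLE-LEVEL SMALL-FIELD CLASS OF FLOW-FREE LIFTED TERMS** (policy
`1 ≤ jcut K ≤ K₀ + K`; class set `T ⊇` run B's keys; ANY weight `w`; NO `RAgree`): `Σ_{x ∈ T ∖ badKeysSigma} B x = Σ_{u : u.Λ (jcut K) = T_η} w (liftShift u)`, `u` over the
admissible indices of run B's own history read one level up.  Under `RAgree` those indices ARE run A's (`Node00.dOfRecord_shift_eq_of_rAgree`) and module 3's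
`sum_sdiff_badKeysSigma_fiberB_eq_sum_liftSeq` is the same sum; off `RAgree` (the jump window of `R_k`) THIS is the honest form.
[cite: Balaban1989LargeFieldI, (0.2)–(0.4) p.176; Balaban1988Convergent, (2.1) p.254, (2.5) p.255, (2.18) p.257; King1986, (3.10) p.656 (bookkeeping)] -/
theorem sum_sdiff_badKeysSigma_fiberB_eq_sum_liftShift (gBK : ℕ → ℝ) (T : Finset (Σ K, SiteSeqKey F (K₀ + K))) (jcut : ℕ → ℕ) (K : ℕ)
    (h1 : 1 ≤ jcut K) (hj : jcut K ≤ K₀ + K)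
    (hT : ∀ s' : SeqOfRecord F ν M gBK (K₀ + K + 1) (K₀ + K + 1), (⟨K, twoRunKeyB F ν hM gBK (K₀ + K) (K₀ + K) s'⟩ : Σ K, SiteSeqKey F (K₀ + K)) ∈ T)
    {β : Type*} [AddCommMonoid β] (w : SeqOfRecord F ν M gBK (K₀ + K + 1) (K₀ + K + 1) → β) :
    ∑ x ∈ T \ badKeysSigma F T jcut, ∑ s' ∈ Finset.univ.filter (fun s' : SeqOfRecord F ν M gBK (K₀ + K + 1) (K₀ + K + 1) =>
        (⟨K, twoRunKeyB F ν hM gBK (K₀ + K) (K₀ + K) s'⟩ : Σ K, SiteSeqKey F (K₀ + K)) = x), w s'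
      = ∑ u ∈ Finset.univ.filter (fun u : Seq (DOfRecord F ν M (fun j => gBK (j + 1)) (K₀ + K)) (K₀ + K) => u.Λ (jcut K) = Set.univ),
          w (liftShift F ν hM gBK u) := by
  rw [sum_sdiff_fiberB_eq_sum_filter F ν hM K₀ gBK T _ K hT w]
  have hfilter : Finset.univ.filter (fun s' : SeqOfRecord F ν M gBK (K₀ + K + 1) (K₀ + K + 1) =>
        (⟨K, twoRunKeyB F ν hM gBK (K₀ + K) (K₀ + K) s'⟩ : Σ K, SiteSeqKey F (K₀ + K)) ∉ badKeysSigma F T jcut)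
      = Finset.univ.filter (fun s' : SeqOfRecord F ν M gBK (K₀ + K + 1) (K₀ + K + 1) => s'.Λ (jcut K + 1) = Set.univ) := by
    refine Finset.filter_congr fun s' _ => ?_
    rw [sigma_twoRunKeyB_mem_badKeysSigma_iff F ν hM gBK T jcut K h1 hj s' (hT s'), not_not]
  rw [hfilter, sum_filter_Λ_succ_eq_univ_eq_sum_liftShift F ν hM gBK h1 hj w]

end Keys

end Summit.QuantumFields.YangMills.BalabanUVNodes.N20TwoRunKeyedGoodFibreFlowFree

end
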